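import Literature.Analysis.FluidPDE.StationaryEulerPlanarHull
import HarnessLib

/-!
# The relaxed family in dimension two (Choffrut–Székelyhidi 2014, Prop. 15, Cor. 16)

Topic `Literature/Analysis/FluidPDE`. Support file of the proof of
`Literature.Analysis.FluidPDE.Torus.ChoffrutSzekelyhidi2014_thm1` (Choffrut–Székelyhidi, SIAM
J. Math. Anal. 46 (2014) = arXiv:1401.4301), §5.3: the sets `𝒰_r = 𝒱_r^{lc}` form a
`RelaxedFamily` for `d = 2` — relative joint openness (Prop. 15 (i) and Lemma 9, with the
monotonicity `𝒰_{r'} ⊆ 𝒰_r`), `𝒰_r ⊆ 𝒦_r^{co}`, property (*) `𝒦_{r'} ⊆ 𝒰_r` (Prop. 15 (ii)), and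
the laminate property Prop. 15 (iii): every `w ∈ 𝒰_r` is the barycentre of a finite-order
laminate valid in `𝒰_r` with atoms in `𝒦_{r'}`, `r - ε < r' < r` (Lemma 9 gives a laminate with
atoms in `𝒱_r`; a common `r' < r` with all atoms in `𝒱_{r'}` exists by openness in `r`; each atom
is re-split by the rotated Prop. 14 (iv) at level `r'`, whose validity set `R_θ V̄_{r'}` lies in
`𝒰_r`; grafting by `Laminate.bind`).

## References

* A. Choffrut, L. Székelyhidi Jr., SIAM J. Math. Anal. 46 (2014), §5.3, Prop. 15, Cor. 16.
-/

noncomputable section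

open scoped InnerProductSpace Matrix Topology
open Set Function Metric Filter

namespace Literature.Analysis.FluidPDE

namespace StationaryEuler

variable {d : Type*} [Fintype d] [DecidableEq d]

omit [Fintype d] [DecidableEq d] in
/-- A laminate has an atom. [folklore] -/
theorem Laminate.exists_of_allAtoms {P : State d → Prop} {T : Laminate d} (h : T.AllAtoms P) : ∃ w, P w := by
  induction T with
  | atom w => exact ⟨w, h⟩
  | split t η q l r ihl _ => exact ihl h.1

namespace Frame2

variable (φ : Frame2 d)

/-- **A common level for the atoms**: if all atoms of `T` lie in `𝒱_r`, they lie in `𝒱_s` for all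
`s` near `r`. [cite: ChoffrutSzekelyhidi2014, Prop. 15 (iii) ("choose `r - ε < r' < r`")] -/
theorem exists_delta_atoms {r : ℝ} {T : Laminate d} (hA : T.AllAtoms (· ∈ φ.calV r)) :
    ∃ δ > 0, ∀ s, |s - r| < δ → T.AllAtoms (· ∈ φ.calV s) := by
  induction T with
  | atom w =>
    obtain ⟨δ, hδ, h⟩ := φ.calV_jointly_open hA
    exact ⟨δ, hδ, fun s hs => h s w hs hA.1 (by rw [dist_self]; exact hδ)⟩
  | split t η q l r ihl ihr =>
    obtain ⟨δ₁, h₁, H₁⟩ := ihl hA.1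
    obtain ⟨δ₂, h₂, H₂⟩ := ihr hA.2
    exact ⟨min δ₁ δ₂, lt_min h₁ h₂, fun s hs =>
      ⟨H₁ s (lt_of_lt_of_le hs (min_le_left _ _)), H₂ s (lt_of_lt_of_le hs (min_le_right _ _))⟩⟩

/-- **Re-splitting an atom** (Prop. 14 (iv) rotated, at level `r' < r`): a point of `𝒱_{r'}` is the
barycentre of a laminate valid in `𝒰_r` with atoms in `𝒦_{r'}`. [cite: ChoffrutSzekelyhidi2014, Prop. 15 (iii)] -/
theorem exists_laminate_atom {r r' : ℝ} (hr' : 0 < r') (hrr : r' < r) {α : State d} (hα : α ∈ φ.calV r') :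
    ∃ T : Laminate d, T.IsValid (φ.U2 r) ∧ T.bary = α ∧ T.AllAtoms (· ∈ K r') := by
  obtain ⟨hadm, hρ0, hρr, hF⟩ := hα
  obtain ⟨κ, l, a, b, hκl, hα_eq, ha, hb⟩ := φ.rot_decomp hadm hρ0
  have hf : frfun r' a b (φ.rho α) < 1 := by
    have := φ.Ffun_rot hκl r' a b hρ0.ne'
    rw [← hα_eq] at this
    rwa [← this]
  have hc : |φ.rho α| < r' / 2 := by rw [abs_of_pos hρ0]; exact hρr
  have hA := Ac_pos hr' hc
  have hB := Bc_pos hr' hc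
  have hg : gfun r' a b (φ.rho α) ≤ 0 := by
    rw [gfun_eq hr']
    have e1 : Real.sqrt r' * |a| / (r' / 2 + φ.rho α) = |a| / Ac r' (φ.rho α) := by rw [Ac]; field_simp
    have e2 : Real.sqrt r' * |b| / (r' / 2 - φ.rho α) = |b| / Bc r' (φ.rho α) := by rw [Bc]; field_simp
    rw [frfun, e1, e2, div_add_div _ _ hA.ne' hB.ne', div_lt_one (mul_pos hA hB)] at hf
    nlinarith [hr']
  obtain ⟨T, hT, hbary, hK⟩ := φ.exists_planarLaminate hκl hr' hc hg
  exact ⟨T, hT.mono (φ.Wrot_subset_U2 hκl hr' hrr), by rw [hbary, ← hα_eq], hK⟩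

/-- **The planar relaxed family** `𝒰_r = 𝒱_r^{lc}` (Prop. 15, Cor. 16). [cite: ChoffrutSzekelyhidi2014, Prop. 15, Cor. 16] -/
def relaxedFamily2 : RelaxedFamily d where
  U := φ.U2
  subset_C := φ.U2_subset_C
  relOpen := by
    intro r w hw
    obtain ⟨T, hT, hbary, hA⟩ := exists_laminate_of_mem_lcHull hw
    obtain ⟨δ₁, hδ₁, hatoms⟩ := φ.exists_delta_atoms hA
    have hw' : w ∈ φ.U2 (r - δ₁ / 2) := by
      have hv := Laminate.isValid_lcHull_of_allAtoms hT (hatoms (r - δ₁ / 2)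
        (by rw [show r - δ₁ / 2 - r = -(δ₁ / 2) by ring, abs_neg, abs_of_pos (half_pos hδ₁)]; linarith))
      rw [← hbary]; exact hv.bary_mem
    obtain ⟨δ₂, hδ₂, hopen⟩ := φ.isRelOpen_U2 (r - δ₁ / 2) w hw'
    refine ⟨min (δ₁ / 2) δ₂, lt_min (half_pos hδ₁) hδ₂, fun r' w' hr hw'adm hd => ?_⟩
    have h1 : w' ∈ φ.U2 (r - δ₁ / 2) := hopen w' hw'adm (lt_of_lt_of_le hd (min_le_right _ _))
    have h2 : r - δ₁ / 2 ≤ r' := by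
      have := (abs_lt.1 (lt_of_lt_of_le hr (min_le_left _ _))).1; linarith
    exact φ.U2_mono h2 h1
  K_subset := fun _ _ h0 hlt => φ.K_subset_U2 h0 hlt
  laminate := by
    intro r w hw ε hε
    obtain ⟨T₀, hT₀, hbary, hA⟩ := exists_laminate_of_mem_lcHull hw
    obtain ⟨δ, hδ, hatoms⟩ := φ.exists_delta_atoms hA
    have hr : 0 < r := by
      obtain ⟨α, hα⟩ := Laminate.exists_of_allAtoms hA
      linarith [hα.2.1, hα.2.2.1]
    set r' : ℝ := max (r - min δ ε / 2) (r / 2) with hr'def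
    have hm : 0 < min δ ε := lt_min hδ hε
    have hr'r : r' < r := max_lt (by linarith) (by linarith)
    have hr'ε : r - ε < r' := lt_of_lt_of_le (by linarith [min_le_right δ ε]) (le_max_left _ _)
    have hr'0 : 0 < r' := lt_of_lt_of_le (half_pos hr) (le_max_right _ _)
    have hr'δ : |r' - r| < δ := by
      rw [abs_sub_comm, abs_of_pos (by linarith)]
      have : r - min δ ε / 2 ≤ r' := le_max_left _ _
      linarith [min_le_left δ ε]
    have hA' : T₀.AllAtoms (· ∈ φ.calV r') := hatoms r' hr'δ
    -- graft the planar laminates onto the atoms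
    classical
    let g : State d → Laminate d := fun α =>
      if h : α ∈ φ.calV r' then Classical.choose (φ.exists_laminate_atom hr'0 hr'r h) else Laminate.atom α
    have hg_eq : ∀ α (hα : α ∈ φ.calV r'), g α = Classical.choose (φ.exists_laminate_atom hr'0 hr'r hα) :=
      fun α hα => dif_pos hα
    have hg : T₀.AllAtoms fun α => (g α).IsValid (φ.U2 r) ∧ (g α).bary = α :=
      hA'.mono fun α hα => by
        have hs := Classical.choose_spec (φ.exists_laminate_atom hr'0 hr'r hα)
        rw [hg_eq α hα]
        exact ⟨hs.1, hs.2.1⟩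
    have hgK : T₀.AllAtoms fun α => (g α).AllAtoms (· ∈ K r') :=
      hA'.mono fun α hα => by
        have hs := Classical.choose_spec (φ.exists_laminate_atom hr'0 hr'r hα)
        rw [hg_eq α hα]
        exact hs.2.2
    refine ⟨r', hr'ε, hr'r, hr'0.le, T₀.bind g, Laminate.isValid_bind hT₀ hg, ?_, Laminate.allAtoms_bind hgK⟩
    rw [Laminate.bary_bind (hg.mono fun α h => h.2), hbary]

end Frame2

/-- **The planar relaxed family** from `Fintype.card d = 2`. [cite: ChoffrutSzekelyhidi2014, Cor. 16] -/
def TwoDim.relaxedFamily (h : Fintype.card d = 2) : RelaxedFamily d :=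
  (Frame2.nonempty_of_card h).some.relaxedFamily2

end StationaryEuler

end Literature.Analysis.FluidPDE
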